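import Literature.NumberTheory.EllipticCurves.ZpExtensionEisensteinTwistRestrictedDualityProofs
import Literature.NumberTheory.EllipticCurves.TorsionFilAtConjugatePairingProofs
import Literature.NumberTheory.EllipticCurves.ZpExtensionEisensteinSelmerStructure
import Literature.NumberTheory.EllipticCurves.OrdinaryReductionAscentProofs
import Literature.NumberTheory.EllipticCurves.TorsionFilAtCyclicOfFrobeniusTraceProofs
import HarnessLib

/-!
# The restricted duality form of the curve's Eisenstein levels is perfect: `A_{m,j} ⊗ Fil_v E[p^j]` against
# `W_j / δ_v·(A_{m,j} ⊗ Fil_{σv} E[p^j])` (theorems only; no definition, no named fact, no instance, no `sorry`)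

Topic `NumberTheory/EllipticCurves` (cell `pub/bsd-print-x9`, LAST GLUE of brick (B3) of `HOME/p1/H4-EXACT-AT-P-PLAN`; sequel to
`ZpExtensionEisensteinTwistRestrictedDualityProofs` (lift of (E-orth)/(E-R)/(E-S) to the spans `A_{m,j} ⊗ Fil`) and
`TorsionFilAtConjugatePairingProofs` (the `E`-level clauses for `ẽ_j = log e_j(·, τ_* ·)` at a good ordinary `v ∋ p`)).

Howard [Compositio Math. 140 (2004), Lemma 2.1.1, §1.3 H.4, Lemma 3.1.1; arXiv:1202.6340 p. 7 L69–82, p. 15 L56–62]: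
`e_𝔭(t₁ ⊗ α₁, t₂ ⊗ α₂) = e(t₁, t₂^τ) α₁ α₂` and «`Fil_v(T_𝔭)` is its own exact orthogonal complement under `e_𝔭`».  For the
D-family's level-`j` form `E = eisensteinDualityForm hm j eb_j` on `W_j = E_K[p^j] ⊗ A_{m,j}`, the plus part
`V = A_{m,j} ⊗ Fil_v E[p^j]` (`OrdinaryFiltration.twistedFil` of `ordinaryFiltrationAt v`) and the transported plus part at `σ v`,
`V′ = δ_v · (A_{m,j} ⊗ Fil_{σv} E[p^j])` (the submodule met in `ConjugationDatum.map_transportH1_strictSubgroup_eq`), this file proves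
the three hypotheses of `Howard2004.DualityDatum.exists_restrictedPairing` / `restrictedPairing_cupProduct_nondegenerate`:

* §1 `ZpExtension.map_eisensteinTwist_span_tmul` — `W_j(g) · (A ⊗ Fil) = A ⊗ (g · Fil)` for the twisted action
  (`g · (c ⊗ a) = (u c) ⊗ g a`, `u` a unit): the transported plus part IS a twisted span;
* §2 **`WeierstrassCurve.eisensteinDualityForm_torsionFilAt_restricted_perfect`** — for the canonical datum `ofLifts σ … τ …`,
  a place `v ∋ p` of good reduction with an ordinary point, `e_j` alternating with trivial right kernel, `log_j` injective, `τ_*`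
  involutive:  (horth) `E(V, V′) = 0`;  (hR) `λ_j(E(V, t)) = 0 ⇒ t ∈ V′`;  (hS) every `φ : V →+ ℤ/p^j` is `λ_j(E(·, t))|_V`
  (`λ_j = tailFormZMod`) — verbatim the inputs `horth`/`hR`/`hS` of the Howard-level file once `(D k).e` is rewritten by the
  D-family's `hDe`.

No summit statement is proved; BSD is not proved by any of this.  Seat `bsd-line-x10b-p1-w7` g2.

References: [Howard2004HeegnerKolyvagin] Lemma 2.1.1, §1.3 H.4, §3.1, Lemma 3.1.1 (arXiv:1202.6340 p. 7 L69–88, p. 15 L56–62);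
[GreenbergLNM1716] §2; [SilvermanAEC2009] III.8.1, VII.2; [Washington1997] §13.2.
-/

noncomputable section

open scoped TensorProduct
open Function NumberField IsDedekindDomain Field

namespace Literature.NumberTheory.EllipticCurves

namespace ZpExtension

open IwasawaAlgebra Literature.NumberTheory.GaloisRepresentations

variable {K : Type} [Field K] {p : ℕ} [hp : Fact p.Prime] (κ : ZpExtension K p) {M : Type} [AddCommGroup M]
  [TopologicalSpace M] [DiscreteTopology M] (ρ : DiscreteGaloisModule K M) {m : ℕ} (hm : 1 ≤ m) (k : ℕ)

/-! ## §1 The twisted action carries `A ⊗ Fil` onto `A ⊗ (g · Fil)` -/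

/-- **`W(g) · (A_{m,k} ⊗ Fil) = A_{m,k} ⊗ ρ(g)·Fil`**: the twisted action `g · (c ⊗ a) = ((1+T)^{e(g)} c) ⊗ ρ(g) a` carries the span
`{c ⊗ a | a ∈ Fil}` onto the span `{c ⊗ b | b ∈ ρ(g)·Fil}` (the unit `(1+T)^{e(g)}` has the inverse `(1+T)^{e′}`,
`p^J ∣ e(g) + e′`).  Used with `g = δ_v`: the transported plus part at `σ v` is the twisted span of `δ_v · Fil_{σv}`.
[cite: Howard2004HeegnerKolyvagin, §2.2 and §3.1 (arXiv p. 15: Fil_v T_𝔮 = Fil_v T ⊗ S_𝔮)] [cite: Washington1997, §13.2] -/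
theorem map_eisensteinTwist_span_tmul (Fil : Submodule ℤ M) (g : absoluteGaloisGroup K) :
    (Submodule.span ℤ {x | ∃ (c : EisensteinCoeff p m k) (a : M), a ∈ Fil ∧ x = EisensteinCoeff.Twisted.tmul c a}).map
        (κ.eisensteinTwist ρ hm k g) =
      Submodule.span ℤ {x | ∃ (c : EisensteinCoeff p m k) (b : M), b ∈ Fil.map (ρ g) ∧
        x = EisensteinCoeff.Twisted.tmul c b} := by
  set u := EisensteinCoeff.onePlusT p m k ^ κ.twistExponent (eisensteinLevel (p := p) hm k) g with hu
  -- an inverse of the unit `u`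
  set e₁ := κ.twistExponent (eisensteinLevel (p := p) hm k) g with he₁
  set w := EisensteinCoeff.onePlusT p m k ^ (p ^ eisensteinLevel (p := p) hm k * e₁ - e₁) with hw
  have hwu : w * u = 1 := by
    rw [hw, hu, mul_comm]
    refine onePlusT_pow_mul_onePlusT_pow_eq_one hm k ⟨e₁, ?_⟩
    have hle : e₁ ≤ p ^ eisensteinLevel (p := p) hm k * e₁ :=
      Nat.le_mul_of_pos_left e₁ (pow_pos hp.out.pos _)
    rw [Nat.add_sub_cancel' hle]
  apply le_antisymm
  · rw [Submodule.map_le_iff_le_comap, Submodule.span_le]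
    rintro x ⟨c, a, ha, rfl⟩
    rw [SetLike.mem_coe, Submodule.mem_comap, eisensteinTwist_apply_tmul]
    exact Submodule.subset_span ⟨_, ρ g a, Submodule.mem_map_of_mem ha, rfl⟩
  · rw [Submodule.span_le]
    rintro x ⟨c, b, hb, rfl⟩
    obtain ⟨a, ha, rfl⟩ := Submodule.mem_map.mp hb
    refine ⟨EisensteinCoeff.Twisted.tmul (w * c) a, Submodule.subset_span ⟨_, a, ha, rfl⟩, ?_⟩
    rw [eisensteinTwist_apply_tmul, ← hu, ← mul_assoc, mul_comm u w, hwu, one_mul]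

end ZpExtension

end Literature.NumberTheory.EllipticCurves

/-! ## §2 The curve: the three hypotheses of the restricted pairing, for the twisted spans of `Fil_v` and `δ_v·Fil_{σv}` -/

namespace WeierstrassCurve

open Literature.NumberTheory.EllipticCurves Literature.NumberTheory.GaloisRepresentations
open Literature.NumberTheory.GaloisCohomology.Howard2004 Literature.NumberTheory.EllipticCurves.IwasawaAlgebra
open Literature.NumberTheory.EllipticCurves.ZpExtension

variable {K : Type} [Field K] [NumberField K] (W : WeierstrassCurve ℚ) [W.IsElliptic] {p : ℕ} [hp : Fact p.Prime]
  {m : ℕ} (hm : 1 ≤ m)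
  (σ : K ≃ₐ[ℚ] K) (hσ₁ : σ ≠ 1) (hσ : σ * σ = 1) (τ : AlgebraicClosure K ≃+* AlgebraicClosure K)
  (hτ : IsLiftOfAut σ τ) (hτ₂ : Function.Involutive τ)

/-- **The restricted duality form of the curve's Eisenstein level `j` is perfect** (Howard's Lemma 3.1.1 for `e_𝔮` at the finite level
`W_j = E_K[p^j] ⊗ A_{m,j}`): for the `E`-level form `ẽ_j = conjPairing e_j τ_* log_j` (the D-family's `(D k).e = eisensteinDualityForm hm (k+1) ẽ_{k+1}`),
the canonical conjugation datum `ofLifts σ … τ …`, a place `v ∋ p` of good reduction with an ordinary point, and the twisted spans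
`V = A ⊗ Fil_v E[p^j]`, `V′ = A ⊗ δ_v·Fil_{σv} E[p^j]`:
(horth) `E(V, V′) = 0`;  (hR) if `λ_j(E(s, t)) = 0` for all `s ∈ V` then `t ∈ V′`;  (hS) every additive `φ : V → ℤ/p^j` is
`s ↦ λ_j(E(s, t))` for some `t` — the hypotheses `horth`, `hR`, `hS` of `Howard2004.DualityDatum.exists_restrictedPairing` /
`restrictedPairing_cupProduct_nondegenerate` (with `λ = tailFormZMod`).  Inputs on `e_j`/`log_j`/`τ_*`: alternating, trivial right
kernel, injective, involutive. [cite: Howard2004HeegnerKolyvagin, Lemma 2.1.1, §1.3 H.4 and Lemma 3.1.1 (arXiv:1202.6340 p. 7 L69–88, p. 15 L56–62)]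
[cite: GreenbergLNM1716, §2 (pp. 82–83)] [cite: SilvermanAEC2009, III.8.1] -/
theorem eisensteinDualityForm_torsionFilAt_restricted_perfect (v : HeightOneSpectrum (𝓞 K))
    (hgood : (W.baseChange K).HasGoodReductionAt v) (hpv : (p : 𝓞 K) ∈ v.asIdeal)
    (hord : ∃ P : localPoints (W.baseChange K) (v.adicCompletion K), (p : ℤ) • P = 0 ∧
      P ∉ (W.baseChange K).localKernelOfReduction v)
    (j : ℕ) (e : geomTorsion (W.baseChange K) ((p : ℤ) ^ j) →+ geomTorsion (W.baseChange K) ((p : ℤ) ^ j) →+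
      DiscreteGaloisModule.MuCarrier K (p ^ j))
    (log : DiscreteGaloisModule.MuCarrier K (p ^ j) →+ ZMod (p ^ j)) (hlog : Injective log)
    (halt : ∀ a, e a a = 0) (hnd : ∀ b, (∀ a, e a b = 0) → b = 0)
    (hθθ : ∀ a : geomTorsion (W.baseChange K) ((p : ℤ) ^ j), hτ.torsionMap W _ (hτ.torsionMap W _ a) = a) :
    let eb := conjPairing e (hτ.torsionMap W ((p : ℤ) ^ j)) log
    let V : Submodule ℤ (EisensteinCoeff.Twisted p m j (geomTorsion (W.baseChange K) ((p : ℤ) ^ j))) :=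
      Submodule.span ℤ {x | ∃ (c : EisensteinCoeff p m j) (a : geomTorsion (W.baseChange K) ((p : ℤ) ^ j)),
        a ∈ (W.baseChange K).torsionFilAt v ((p : ℤ) ^ j) ∧ x = EisensteinCoeff.Twisted.tmul c a}
    let V' : Submodule ℤ (EisensteinCoeff.Twisted p m j (geomTorsion (W.baseChange K) ((p : ℤ) ^ j))) :=
      Submodule.span ℤ {x | ∃ (c : EisensteinCoeff p m j) (b : geomTorsion (W.baseChange K) ((p : ℤ) ^ j)),
        b ∈ ((W.baseChange K).torsionFilAt (σ • v) ((p : ℤ) ^ j)).map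
          ((W.baseChange K).torsionGaloisModule ((p : ℤ) ^ j) ((ConjugationDatum.ofLifts σ hσ₁ hσ τ hτ hτ₂).δ v)) ∧
        x = EisensteinCoeff.Twisted.tmul c b}
    (∀ s ∈ V, ∀ t ∈ V', eisensteinDualityForm hm j eb s t = 0) ∧
      (∀ t, (∀ s ∈ V, EisensteinCoeff.tailFormZMod p hm j (eisensteinDualityForm hm j eb s t) = 0) → t ∈ V') ∧
      (∀ φ : V →+ ZMod (p ^ j), ∃ t, ∀ s : V,
        EisensteinCoeff.tailFormZMod p hm j (eisensteinDualityForm hm j eb (s : _) t) = φ s) := by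
  intro eb V V'
  obtain ⟨horth, hR, hS⟩ := W.conjPairing_torsionFilAt_clauses σ hσ₁ hσ τ hτ hτ₂ v hgood hpv hord j e log hlog halt hnd hθθ
  refine ⟨fun s hs t ht ↦ ?_, fun t ht ↦ ?_, fun φ ↦ ?_⟩
  · exact eisensteinDualityForm_eq_zero_of_mem_span_tmul hm j eb _ _ horth hs ht
  · exact mem_span_tmul_of_forall_tailFormZMod_eisensteinDualityForm_eq_zero hm j eb _ _ hR t ht
  · obtain ⟨t, ht⟩ := exists_forall_tailFormZMod_eisensteinDualityForm_eq_of_mem_span_tmul hm j eb _ hS φ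
    exact ⟨t, fun s ↦ ht s s.2⟩

/-- **The same, with the ordinary hypotheses discharged from `IsOrdinaryAt W p`** (`E/ℚ` globally minimal, good ordinary at `p`:
`Thm413Hypotheses.ordinary`): good reduction of `E_K` at `v ∋ p` ascends (`hasGoodReductionAt_baseChange_of_hasGoodReductionAtPrime`),
`p ∤ a_v(E_K)` (`not_dvd_frobeniusTraceAt_baseChange_of_isOrdinaryAt`) and the ordinary point exists
(`exists_ordinaryPoint_local_of_not_dvd_frobeniusTraceAt`). [cite: Howard2004HeegnerKolyvagin, §3.1 and Lemma 3.1.1 (arXiv:1202.6340 p. 15, L56–62)]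
[cite: SilvermanAEC2009, V.3.1, VII.2, VII.5.1] [cite: GreenbergLNM1716, §1 p. 62, §2] -/
theorem eisensteinDualityForm_torsionFilAt_restricted_perfect_of_isOrdinaryAt [W.IsGloballyMinimal] (hordW : IsOrdinaryAt W p)
    (v : HeightOneSpectrum (𝓞 K)) (hpv : ((p : ℕ) : 𝓞 K) ∈ v.asIdeal)
    (j : ℕ) (e : geomTorsion (W.baseChange K) ((p : ℤ) ^ j) →+ geomTorsion (W.baseChange K) ((p : ℤ) ^ j) →+
      DiscreteGaloisModule.MuCarrier K (p ^ j))
    (log : DiscreteGaloisModule.MuCarrier K (p ^ j) →+ ZMod (p ^ j)) (hlog : Injective log)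
    (halt : ∀ a, e a a = 0) (hnd : ∀ b, (∀ a, e a b = 0) → b = 0)
    (hθθ : ∀ a : geomTorsion (W.baseChange K) ((p : ℤ) ^ j), hτ.torsionMap W _ (hτ.torsionMap W _ a) = a) :
    let eb := conjPairing e (hτ.torsionMap W ((p : ℤ) ^ j)) log
    let V : Submodule ℤ (EisensteinCoeff.Twisted p m j (geomTorsion (W.baseChange K) ((p : ℤ) ^ j))) :=
      Submodule.span ℤ {x | ∃ (c : EisensteinCoeff p m j) (a : geomTorsion (W.baseChange K) ((p : ℤ) ^ j)),
        a ∈ (W.baseChange K).torsionFilAt v ((p : ℤ) ^ j) ∧ x = EisensteinCoeff.Twisted.tmul c a}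
    let V' : Submodule ℤ (EisensteinCoeff.Twisted p m j (geomTorsion (W.baseChange K) ((p : ℤ) ^ j))) :=
      Submodule.span ℤ {x | ∃ (c : EisensteinCoeff p m j) (b : geomTorsion (W.baseChange K) ((p : ℤ) ^ j)),
        b ∈ ((W.baseChange K).torsionFilAt (σ • v) ((p : ℤ) ^ j)).map
          ((W.baseChange K).torsionGaloisModule ((p : ℤ) ^ j) ((ConjugationDatum.ofLifts σ hσ₁ hσ τ hτ hτ₂).δ v)) ∧
        x = EisensteinCoeff.Twisted.tmul c b}
    (∀ s ∈ V, ∀ t ∈ V', eisensteinDualityForm hm j eb s t = 0) ∧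
      (∀ t, (∀ s ∈ V, EisensteinCoeff.tailFormZMod p hm j (eisensteinDualityForm hm j eb s t) = 0) → t ∈ V') ∧
      (∀ φ : V →+ ZMod (p ^ j), ∃ t, ∀ s : V,
        EisensteinCoeff.tailFormZMod p hm j (eisensteinDualityForm hm j eb (s : _) t) = φ s) := by
  have hgood : (W.baseChange K).HasGoodReductionAt v :=
    W.hasGoodReductionAt_baseChange_of_hasGoodReductionAtPrime hordW.1 v hpv
  have hord := (W.baseChange K).exists_ordinaryPoint_local_of_not_dvd_frobeniusTraceAt v hgood hpv
    (W.not_dvd_frobeniusTraceAt_baseChange_of_isOrdinaryAt hordW v hpv)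
  exact W.eisensteinDualityForm_torsionFilAt_restricted_perfect hm σ hσ₁ hσ τ hτ hτ₂ v hgood hpv hord j e log hlog halt hnd hθθ

end WeierstrassCurve

end
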